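import Literature.NumberTheory.EllipticCurves.RootNumberTableTwoInvarianceProofs
import Literature.NumberTheory.EllipticCurves.RootNumberLocalSmulProofs
import HarnessLib

/-!
# The table-local root numbers `W.tableLocalRootNumberAt⁽'⁾ v` and their product over all places
# do not depend on the Weierstrass equation — proofs

Proof file (no new definition, no new fact) completing
`Literature.NumberTheory.EllipticCurves.RootNumberTableTwoInvarianceProofs` (the `ℚ₂` table value
`W.rootNumberTwo⁽'⁾` is a function of the curve) at ALL finite places.  The tree's
`WeierstrassCurve.tableLocalRootNumberAt⁽'⁾ W v` (`Literature.NumberTheory.EllipticCurves.RootNumberTableTwo`)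
is the Kellock–Dokchitser table value `W.rootNumberTwo⁽'⁾` above `2` and Rohrlich's local root number
`W.localRootNumberAt v` elsewhere, and the named fact
`WeierstrassCurve.rootNumber_eq_neg_finprod_tableLocalRootNumberAt'` (Kellock–Dokchitser 2023,
Def. 2.1 / Thm. 2.3 / §5; Rizzo 2003) equates `−∏ᶠ_v W.tableLocalRootNumberAt' v` with the global root
number `w(E)`.  Both sides of that fact are attached to an EQUATION `W / ℚ`; its left side
`W.rootNumber` is an invariant of the curve by `WeierstrassCurve.rootNumber_smul_holds`
(`…RootNumberSmulProofs`), and this file shows the same for the right side: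

* `WeierstrassCurve.localRootNumberAt_variableChange`: for an elliptic `W` over the fraction field
  `K` of a Dedekind domain and any change of variables `C` over `K`,
  `(C • W).localRootNumberAt v = W.localRootNumberAt v` at every finite place `v` — the global
  reading of the tree's local theorem `WeierstrassCurve.localRootNumber_smul_holds`
  (`…RootNumberLocalSmulProofs`: Rohrlich 1994, §19, `W(E/K_v)` is attached to `E / K_v`; Silverman,
  AEC VII.1 Prop. 1.3(b)), transported along `(C • W) ⊗ K_v = C_{K_v} • (W ⊗ K_v)` (Mathlib's
  `WeierstrassCurve.map_variableChange`);
* `WeierstrassCurve.algebraicRootNumber_variableChange`: `−∏ᶠ_v W_v(E)` (`W.algebraicRootNumber`,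
  Rohrlich 1994, §20) is an invariant of the elliptic curve;
* `WeierstrassCurve.tableLocalRootNumberAt_variableChange`, `…tableLocalRootNumberAt'_variableChange`
  (elliptic `W / ℚ`, every `C : VariableChange ℚ`, every `v`): by the previous item away from `2` and
  by `WeierstrassCurve.rootNumberTwo⁽'⁾_variableChange_of_isElliptic` above `2`;
* `WeierstrassCurve.finprod_tableLocalRootNumberAt_variableChange`,
  `…finprod_tableLocalRootNumberAt'_variableChange`: hence the products over all finite places, i.e.
  the right side of `rootNumber_eq_neg_finprod_tableLocalRootNumberAt'`, are invariants of the curve.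

`[W.IsElliptic]` is needed away from `2` (for a singular `W` the minimal model behind
`localRootNumber` is an arbitrary choice, see `Literature.NumberTheory.EllipticCurves.RootNumber`);
above `2` the table theorems only need `Δ ≠ 0`.

## References
* [Rohrlich1994CRM] D. E. Rohrlich, *Elliptic curves and the Weil–Deligne group*, CRM Proc. Lecture
  Notes 4 (1994), §19–§20.
* [SilvermanAEC2009] J. H. Silverman, *The Arithmetic of Elliptic Curves*, 2nd ed., GTM 106 (2009),
  VII.1 Prop. 1.3(b); III.1 Table 3.1.
* [KellockDokchitser2023] L. Cowland Kellock, V. Dokchitser, *Root numbers and parity phenomena*,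
  Bull. LMS 55 (2023) = arXiv:2303.07883, Def. 2.1, Thm. 2.3, Notation 5.1 and §5.
* [Rizzo2003] O. G. Rizzo, *Average root numbers for a nonconstant family of elliptic curves*,
  Compositio Math. 136 (2003), §1 Fact 3 and Table III.
-/

noncomputable section

namespace WeierstrassCurve

open IsDedekindDomain Literature.NumberTheory.EllipticCurves

/-! ## §1 Rohrlich's local root number at a finite place of a global field -/

section Global

variable {A : Type*} [CommRing A] [IsDedekindDomain A] {K : Type*} [Field K] [Algebra A K]
  [IsFractionRing A K] (C : VariableChange K) (W : WeierstrassCurve K)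

/-- **`W_v(E)` is attached to the curve, not to the equation**: for an elliptic `W / K` and every
change of variables `C` over `K`, `(C • W).localRootNumberAt v = W.localRootNumberAt v` at every
finite place `v` of `K` — since `(C • W) ⊗_K K_v = C_{K_v} • (W ⊗_K K_v)` and the local root number
over `O_v ⊆ K_v` is invariant under changes of variables over `K_v`
(`WeierstrassCurve.localRootNumber_smul_holds`). [cite: Rohrlich1994CRM, §19]
[cite: SilvermanAEC2009, VII.1 Prop. 1.3(b)] -/
theorem localRootNumberAt_variableChange [W.IsElliptic] (v : HeightOneSpectrum A) :
    (C • W).localRootNumberAt v = W.localRootNumberAt v := by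
  haveI : (W.baseChange (v.adicCompletion K)).IsElliptic :=
    inferInstanceAs (W.map (algebraMap K (v.adicCompletion K))).IsElliptic
  unfold localRootNumberAt
  rw [show (C • W).baseChange (v.adicCompletion K)
      = (C.map (algebraMap K (v.adicCompletion K))) • W.baseChange (v.adicCompletion K) from
    (map_variableChange (W := W) (C := C) (φ := algebraMap K (v.adicCompletion K))).symm]
  exact (W.baseChange (v.adicCompletion K)).localRootNumber_smul_holds (v.adicCompletionIntegers K)
    (C.map (algebraMap K (v.adicCompletion K)))

end Global

/-! ## §2 Curves over `ℚ`: the algebraic root number and the table-local root numbers -/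

section Rat

variable (C : VariableChange ℚ) (W : WeierstrassCurve ℚ)

/-- **`−∏_p W_p(E)` is attached to the curve**: `(C • W).algebraicRootNumber = W.algebraicRootNumber`
for an elliptic `W / ℚ` and every change of variables `C` over `ℚ`. [cite: Rohrlich1994CRM, §19–20] -/
theorem algebraicRootNumber_variableChange [W.IsElliptic] :
    (C • W).algebraicRootNumber = W.algebraicRootNumber := by
  unfold algebraicRootNumber
  rw [finprod_congr fun v => localRootNumberAt_variableChange C W v]

/-- **The table-local root number (printed `ℚ₂` table) is attached to the curve**:
`(C • W).tableLocalRootNumberAt v = W.tableLocalRootNumberAt v` for an elliptic `W / ℚ`, every `C`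
over `ℚ` and every finite place `v` — above `2` by `rootNumberTwo_variableChange_of_isElliptic`
(Kellock–Dokchitser, Notation 5.1: any Weierstrass equation), elsewhere by
`localRootNumberAt_variableChange` (Rohrlich). [cite: KellockDokchitser2023, Thm. 2.3 and Notation 5.1]
[cite: Rohrlich1994CRM, §19] -/
theorem tableLocalRootNumberAt_variableChange [W.IsElliptic] (v : HeightOneSpectrum ℤ) :
    (C • W).tableLocalRootNumberAt v = W.tableLocalRootNumberAt v := by
  unfold tableLocalRootNumberAt
  split_ifs
  · exact rootNumberTwo_variableChange_of_isElliptic C W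
  · exact localRootNumberAt_variableChange C W v

/-- **The table-local root number with the CORRECTED `ℚ₂` table is attached to the curve**:
`(C • W).tableLocalRootNumberAt' v = W.tableLocalRootNumberAt' v` for an elliptic `W / ℚ`, every
`C` over `ℚ` and every finite place `v` (`rootNumberTwo'_variableChange_of_isElliptic` above `2`,
`localRootNumberAt_variableChange` elsewhere).
[cite: KellockDokchitser2023, Thm. 2.3 and Notation 5.1, §5 rows (0,5,2) corrected]
[cite: Rizzo2003, §1 Fact 3 and Table III] [cite: Rohrlich1994CRM, §19] -/
theorem tableLocalRootNumberAt'_variableChange [W.IsElliptic] (v : HeightOneSpectrum ℤ) :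
    (C • W).tableLocalRootNumberAt' v = W.tableLocalRootNumberAt' v := by
  unfold tableLocalRootNumberAt'
  split_ifs
  · exact rootNumberTwo'_variableChange_of_isElliptic C W
  · exact localRootNumberAt_variableChange C W v

/-- The product of the table-local root numbers over all finite places (printed `ℚ₂` table) is
attached to the curve. [cite: KellockDokchitser2023, Def. 2.1 and Thm. 2.3] -/
theorem finprod_tableLocalRootNumberAt_variableChange [W.IsElliptic] :
    ∏ᶠ v : HeightOneSpectrum ℤ, (C • W).tableLocalRootNumberAt v
      = ∏ᶠ v : HeightOneSpectrum ℤ, W.tableLocalRootNumberAt v :=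
  finprod_congr fun v => tableLocalRootNumberAt_variableChange C W v

/-- **The right side of `rootNumber_eq_neg_finprod_tableLocalRootNumberAt'` is attached to the
curve**: `∏ᶠ_v (C • W).tableLocalRootNumberAt' v = ∏ᶠ_v W.tableLocalRootNumberAt' v` for an
elliptic `W / ℚ` and every change of variables `C` over `ℚ` (as is its left side `w(E)`,
`WeierstrassCurve.rootNumber_smul_holds`).
[cite: KellockDokchitser2023, Def. 2.1, Thm. 2.3 and §5, rows (0,5,2) corrected]
[cite: Rizzo2003, §1 Fact 3 and Table III] -/
theorem finprod_tableLocalRootNumberAt'_variableChange [W.IsElliptic] :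
    ∏ᶠ v : HeightOneSpectrum ℤ, (C • W).tableLocalRootNumberAt' v
      = ∏ᶠ v : HeightOneSpectrum ℤ, W.tableLocalRootNumberAt' v :=
  finprod_congr fun v => tableLocalRootNumberAt'_variableChange C W v

end Rat

end WeierstrassCurve

end
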